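import Summits.BirchSwinnertonDyer.Rank1Residual.Additive.UnramifiedKummerDisjoint
import Summits.BirchSwinnertonDyer.Rank1Residual.X11b.MaxUnramifiedRestriction
import Literature.NumberTheory.EllipticCurves.KodairaNeronUnramifiedInertiaProofs
import Literature.NumberTheory.EllipticCurves.PeriodIndexSupportProofs
import Literature.NumberTheory.EllipticCurves.SelmerFiniteProofs
import Literature.NumberTheory.EllipticCurves.LocalEulerCharacteristicTorsion
import Literature.NumberTheory.EllipticCurves.CongruenceVisibilityComparison
import Literature.NumberTheory.EllipticCurves.IwasawaSelmerControlLocalInputsProofs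
import Literature.NumberTheory.EllipticCurves.LocalKummerMap
import Literature.NumberTheory.EllipticCurves.CongruenceVisibilityMultiplicativeTwisted
import Literature.NumberTheory.EllipticCurves.SelmerCorankControlRatProofs
import Literature.NumberTheory.EllipticCurves.CongruentNumberCurveSupersingular
import HarnessLib

/-!
# The PARTIAL AGREEMENT of local Kummer conditions of `p`-congruent curves at a place where BOTH
# are GOOD (any residue characteristic, `v ∣ p` allowed, no ramification clause): `ι_v(θ) ≤ #(𝓞_v/p)`
# — UNCONDITIONAL (cell `b2b-bsdres`, unit `b2b-bsdres-x10` = N2 class lead, GEN 22; TOOL, closes nothing)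

HONEST FRAMING (cell `b2b-bsdres`, run/shared/lean/b2b/bsd-rank1-residual/, verbatim in every
file): the goal of the cell is to DELETE the COMBINATION-SHAPED residual classes of the
Birch–Swinnerton-Dyer formula for ALL analytic-rank `≤ 1` elliptic curves over `ℚ` — "full BSD
formula for every rank `≤ 1` curve in class `C`" assembled STRICTLY from published theorems — so
that the rank-`≤ 1` remainder becomes exactly the CONSTRUCTION-SHAPED classes, which are TYPED
(missing-input `Prop`s), NOT attempted. This is not "finishing BSD". Class X10b (= N2) stays
CONSTRUCTION-SHAPED (NEEDS `X_A3`); THIS FILE IS A TOOL (theorems only; no definition, no named fact,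
no `sorry`); nothing is booked; no mark / label / tier / count is changed.

## What

The visibility count (`WeierstrassCurve.exists_sha_ne_zero_of_congr_of_relIndex_lt`, x11a) charges
at each place the COMPARISON INDEX `ι_v(θ) = [θ_* 𝓢_v(E′) : θ_* 𝓢_v(E′) ∩ 𝓢_v(E)]` of the local
Kummer conditions along a `Γ_K`-isomorphism `θ : E′[p] ⥲ E[p]`.  At a place above `p` where both
curves are GOOD the tree had two options: PAY `#𝓛_v(E′) = #E′(K_v)[p] · #(𝓞_v/p)`
(`relIndex_map_selmerLocalKer_ne_zero_and_le`), or the FULL agreement `ι_v = 1` as a NAMED FACT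
(Mazur–Rubin 2015 via Raynaud, `MazurRubin2015/KummerImageGoodReduction.lean`, x10b GEN 15; consumed by
x10 GEN 22's `X10/SelfTwistVisibleGoodAtThree*.lean` for the seven ANOMALOUS N2 self-twist Ш-cells,
where PAY = `3·3 = 9 = 3^{rank E′}` does not close).  THIS FILE proves, with NO named fact:

  **`ι_v(θ) ≤ #(𝓞_v/p)`** whenever `E` and `E′` both have good reduction at `v`
  (`SelfTwist.relIndex_map_selmerLocalKer_le_card_quot_of_hasGoodReductionAt`).

So at a good place above `p` one never pays for the partner's `K_v`-rational `p`-torsion: over `ℚ` at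
`p = 3` the place costs `3`, and a rank-2 partner closes the count (`1·3 < 9`) — the seven anomalous
records WITHOUT `hMR` (sequel file).  (At `v ∤ p` the bound is `1`: criterion 1 again.)

## Proof (the UNRAMIFIED third of the Kummer image transports; x10 GEN 22's KIND (viii) SPEC v2)

* §1 `unramifiedSubgroup_le_kummerLocalConditionAt_of_hasGoodReductionAt` — **at a place of GOOD
  reduction the unramified local classes `H¹_ur(K_v, E[n]) = ker(H¹(K_v, E[n]) → H¹(I_v, E[n]))`
  satisfy the local Kummer condition `𝓛_v(E)`, for EVERY `n`** (also `v ∣ n`): a cocycle of an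
  unramified class is principal on `I_v = absInertia K_v` (x11b `LocBridge.mem_unramifiedSubgroup_one_iff_exists`),
  `= 𝔐.inertia` (`inertia_eq_absInertia`); read in `E(K̄_v)` and corrected by the corresponding
  coboundary it VANISHES on `I_𝔐`, hence is a coboundary by Milne, *ADT* I Prop. 3.8 — the tree's
  DISCHARGED `Milne2006_unramifiedClass_eq_zero_holds` (Lang + Hensel);
* §2 the bound: with `r = res_v ∘ θ_*⁻¹ : θ_* 𝓢_v(E′) → 𝓛_v(E′)` and `U′ = H¹_ur(K_v, E′[p])`,
  the classes of `θ_* 𝓢_v(E′)` whose `r`-image is unramified lie in `𝓢_v(E)` (unramifiedness passes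
  through `θ`; §1 for `E`), so `ι_v(θ) ≤ [𝓛_v(E′) : U′]` (`U′ ≤ 𝓛_v(E′)` by §1 for `E′`); and
  `#U′ = #E′[p]^{Γ_{K_v}} = #E′(K_v)[p]` for the FINITE module `E′[p]` with NO hypothesis on the
  inertia action (n1011-p06's `natCard_unramifiedSubgroup_eq_natCard_invariants_general`: `H¹_ur` is
  the injective inflation from `Γ/I ≅ Ẑ` and `h¹ = h⁰` there; `natCard_invariants_torsion_restrictField`),
  while `#𝓛_v(E′) = #E′(K_v)[p] · #(𝓞_v/p)` (`natCard_kummerLocalConditionAt_adicCompletion`).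

References: [MilneADT2006] I Prop. 3.8, Lemma 2.9, Lemma 3.3; [CremonaMazur2000] §3; [AgasheStein2002]
§3.5; [MazurRubin2015SelmerCompanions] Thm. 3.1 (iv)(b) (the full agreement this bound does not need).
-/

set_option autoImplicit false

noncomputable section

open scoped Classical ContRepresentation
open CategoryTheory Field ValuativeRel NumberField IsDedekindDomain Function
open Literature.NumberTheory.EllipticCurves Literature.NumberTheory.GaloisRepresentations
open Summit.BirchSwinnertonDyer.Rank1Residual.X11b Summit.BirchSwinnertonDyer.Rank1Residual.Additive
open WeierstrassCurve

universe u

namespace Summit.BirchSwinnertonDyer.Rank1Residual.X10.SelfTwist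

section LemmaA

variable {K : Type u} [Field K] [NumberField K] (W : WeierstrassCurve K) [W.IsElliptic]

/-- **§1. Unramified local classes satisfy the local Kummer condition at a GOOD place, for every `n`**
(Milne, *ADT* I Prop. 3.8 — `H¹(K_v^nr/K_v, E(K_v^nr)) = 0` at good reduction —, the tree's discharged
`Milne2006_unramifiedClass_eq_zero_holds`; no `v ∤ n` hypothesis): for `E = W` good at `v`,
`H¹_ur(K_v, E[n]) ≤ 𝓛_v(E) = ker (H¹(K_v, E[n]) → H¹(K_v, E(K̄_v)))`.
[cite: MilneADT2006, Ch. I Prop. 3.8] -/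
theorem unramifiedSubgroup_le_kummerLocalConditionAt_of_hasGoodReductionAt
    {v : HeightOneSpectrum (𝓞 K)} (hv : W.HasGoodReductionAt v) (n : ℤ) :
    DiscreteGaloisModule.unramifiedSubgroup
        (GaloisRep.restrictField (v.adicCompletion K) (W.torsionGaloisModule n)) 1 ≤
      W.kummerLocalConditionAt n (v.adicCompletion K) := by
  intro c hc
  obtain ⟨φ, rfl⟩ := oneCocycleClass_surjective
    (DiscreteGaloisModule.toTopRep (GaloisRep.restrictField (v.adicCompletion K)
      (W.torsionGaloisModule n))) c
  -- the class is principal on the inertia group: `φ τ = τ a - a` for `τ ∈ I_v`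
  obtain ⟨a, ha⟩ := (LocBridge.mem_unramifiedSubgroup_one_iff_exists _ φ).mp hc
  rw [WeierstrassCurve.mem_kummerLocalConditionAt_iff,
    WeierstrassCurve.map_torsionPointsMapIntertwining_oneCocycleClass]
  obtain ⟨𝔐, h𝔐⟩ := v.localPrimesAbove_nonempty
  obtain ⟨w, hw⟩ := IsDedekindDomain.HeightOneSpectrum.exists_spectralValuation (v := v)
  -- the local point `A = ι a` and its coboundary
  set A : localPoints W (v.adicCompletion K) :=
    pointsMap W (v.adicCompletion K) ((a : geomTorsion W n) : geomPoints W) with hA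
  set g := contOneCocycles.pullback (ContinuousMonoidHom.id (absoluteGaloisGroup (v.adicCompletion K)))
      (X := DiscreteGaloisModule.toTopRep (GaloisRep.restrictField (v.adicCompletion K)
        (W.torsionGaloisModule n)))
      (Y := discreteTopRep (absoluteGaloisGroup (v.adicCompletion K)) (localPoints W (v.adicCompletion K)))
      (TopRep.ofHom ⟨(W.torsionPointsMapIntertwining n (v.adicCompletion K)).toContinuousLinearMap,
        (W.torsionPointsMapIntertwining n (v.adicCompletion K)).isIntertwining'⟩) φ with hg
  let cob : contOneCocycles (discreteTopRep (absoluteGaloisGroup (v.adicCompletion K))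
      (localPoints W (v.adicCompletion K))) :=
    ⟨⟨fun σ ↦ σ • A - A, (continuous_smul_localPoints W _ A).sub continuous_const⟩, fun σ τ ↦ by
      change (σ * τ) • A - A = (σ • A - A) + σ • (τ • A - A)
      rw [mul_smul, smul_sub]; abel⟩
  have hcob : oneCocycleClass _ cob = 0 :=
    (oneCocycleClass_eq_zero_iff _ cob).mpr ⟨A, fun _ ↦ rfl⟩
  -- `g - cob` vanishes on `I_𝔐 = absInertia K_v`, hence is a coboundary (Milne I.3.8)
  have hzero : oneCocycleClass _ (g - cob) = 0 := by
    refine Milne2006_unramifiedClass_eq_zero_holds W v hv h𝔐 _ fun σ hσ ↦ ?_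
    have hσ' : σ ∈ absInertia (v.adicCompletion K) := by
      rw [← IsDedekindDomain.HeightOneSpectrum.inertia_eq_absInertia hw h𝔐]; exact hσ
    have h1 := ha σ hσ'
    change pointsMap W (v.adicCompletion K) ((φ.1 σ : geomTorsion W n) : geomPoints W) - (σ • A - A) = 0
    rw [h1]
    change pointsMap W (v.adicCompletion K)
        (((resGal (K := K) (v.adicCompletion K) σ • a - a : geomTorsion W n)) : geomPoints W) -
        (σ • A - A) = 0
    rw [AddSubgroup.coe_sub, map_sub,
      Literature.NumberTheory.EllipticCurves.AddSubgroup.torsionBy.coe_smul, pointsMap_smul, hA,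
      sub_self]
  have : oneCocycleClass _ g = oneCocycleClass _ (g - cob) + oneCocycleClass _ cob := by
    rw [oneCocycleClass_sub, sub_add_cancel]
  rw [this, hzero, hcob, add_zero]
  rfl

end LemmaA

section Main

variable {K : Type} [Field K] [NumberField K] (W W' : WeierstrassCurve K) [W.IsElliptic]
  [W'.IsElliptic] {p : ℕ} [hp : Fact p.Prime]

/-- **§2. THE PARTIAL AGREEMENT at a both-good place (unconditional): `ι_v(θ) ≤ #(𝓞_v/p)`.**
For elliptic curves `E = W`, `E′ = W′` over a number field `K`, a prime `p`, a `Γ_K`-equivariant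
isomorphism `θ : E′[p] ⥲ E[p]`, and a finite place `v` (ANY residue characteristic, `v ∣ p` allowed,
no ramification clause) at which BOTH curves have good reduction:
`[θ_* 𝓢_v(E′) : θ_* 𝓢_v(E′) ∩ 𝓢_v(E)] ≤ #(𝓞_v/p𝓞_v)` (`= p^{[K_v:ℚ_p]}` at `v ∣ p`, `1` at `v ∤ p`).
Proof: the classes of `θ_* 𝓢_v(E′)` whose pull-back restricts into `H¹_ur(K_v, E′[p])` transport into
`H¹_ur(K_v, E[p]) ≤ 𝓛_v(E)` (§1), so the index is at most `[𝓛_v(E′) : H¹_ur(K_v, E′[p])]`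
(`H¹_ur ≤ 𝓛_v(E′)` by §1), `= #E′(K_v)[p]·#(𝓞_v/p) / #E′(K_v)[p]`. Compare Mazur–Rubin 2015 Thm. 3.1
(iv)(b) (full agreement, `e(v|p) < p − 1`, Raynaud) — not used. [cite: MilneADT2006, Ch. I Prop. 3.8 and Lemma 2.9]
[cite: CremonaMazur2000, §3] [cite: AgasheStein2002, Thm. 3.1 and §3.5] -/
theorem relIndex_map_selmerLocalKer_le_card_quot_of_hasGoodReductionAt
    (θ : geomTorsion W' (p : ℤ) ≃+ geomTorsion W (p : ℤ))
    (hθ : ∀ (σ : absoluteGaloisGroup K) (P : geomTorsion W' (p : ℤ)), θ (σ • P) = σ • θ P)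
    {v : HeightOneSpectrum (𝓞 K)} (hW : W.HasGoodReductionAt v) (hW' : W'.HasGoodReductionAt v) :
    (selmerLocalKer W (v.adicCompletion K) (p : ℤ)).relIndex
        ((selmerLocalKer W' (v.adicCompletion K) (p : ℤ)).map (h1Equiv θ hθ).toAddMonoidHom) ≤
      Nat.card (v.adicCompletionIntegers K ⧸
        Ideal.span {(p : v.adicCompletionIntegers K)}) := by
  have hpp : p.Prime := hp.out
  haveI : NeZero p := ⟨hpp.ne_zero⟩
  haveI : Finite (geomTorsion W' (p : ℤ)) := finite_geomTorsion_of_neZero W' p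
  haveI : CharZero (v.adicCompletion K) := charZero_adicCompletion v
  set A : AddSubgroup (galH1Torsion W (p : ℤ)) :=
    (selmerLocalKer W' (v.adicCompletion K) (p : ℤ)).map (h1Equiv θ hθ).toAddMonoidHom with hA
  set Hs : AddSubgroup (galH1Torsion W (p : ℤ)) := selmerLocalKer W (v.adicCompletion K) (p : ℤ)
    with hHs
  set ρ' := GaloisRep.restrictField (v.adicCompletion K) (W'.torsionGaloisModule (p : ℤ)) with hρ'
  set U' : AddSubgroup (galoisCohomology ρ' 1) := DiscreteGaloisModule.unramifiedSubgroup ρ' 1 with hU'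
  set L' : AddSubgroup (galoisCohomology ρ' 1) := W'.kummerLocalConditionAt (p : ℤ) (v.adicCompletion K)
    with hL'
  have hU'L' : U' ≤ L' :=
    unramifiedSubgroup_le_kummerLocalConditionAt_of_hasGoodReductionAt W' hW' (p : ℤ)
  -- `r = res_v ∘ θ_*⁻¹`
  set r : galH1Torsion W (p : ℤ) →+ galoisCohomology ρ' 1 :=
    (galoisCohomology.res (W'.torsionGaloisModule (p : ℤ)) (v.adicCompletion K) 1).comp
      (h1Equiv θ hθ).symm.toAddMonoidHom with hr
  have hr_apply : ∀ c, r c = galoisCohomology.res (W'.torsionGaloisModule (p : ℤ))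
      (v.adicCompletion K) 1 ((h1Equiv θ hθ).symm c) := fun c ↦ rfl
  -- `H₁ = r⁻¹(U′) ≤ 𝓢_v(E)`: the unramified part transports
  set H₁ : AddSubgroup (galH1Torsion W (p : ℤ)) := U'.comap r with hH₁
  have hH₁le : H₁ ≤ Hs := by
    intro c hc
    rw [hH₁, AddSubgroup.mem_comap, hr_apply] at hc
    set c' := (h1Equiv θ hθ).symm c with hc'
    have hcc' : c = h1Equiv θ hθ c' := ((h1Equiv θ hθ).apply_symm_apply c).symm
    obtain ⟨φ, hφ⟩ :=
      oneCocycleClass_surjective (discreteTopRep (absoluteGaloisGroup K) (geomTorsion W' (p : ℤ))) c'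
    rw [← hφ, res_torsionGaloisModule_oneCocycleClass] at hc
    obtain ⟨a, ha⟩ := (LocBridge.mem_unramifiedSubgroup_one_iff_exists _ _).mp hc
    -- `res_v c` is unramified for `E`, hence Kummer by §1
    have key : galoisCohomology.res (W.torsionGaloisModule (p : ℤ)) (v.adicCompletion K) 1 c ∈
        W.kummerLocalConditionAt (p : ℤ) (v.adicCompletion K) := by
      rw [hcc', ← hφ, h1Equiv_oneCocycleClass, res_torsionGaloisModule_oneCocycleClass]
      refine unramifiedSubgroup_le_kummerLocalConditionAt_of_hasGoodReductionAt W hW (p : ℤ) ?_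
      refine (LocBridge.mem_unramifiedSubgroup_one_iff_exists _ _).mpr ⟨θ a, fun τ hτ ↦ ?_⟩
      have h1 := ha τ hτ
      rw [contOneCocycles.pullback_apply] at h1 ⊢
      change θ (φ.1 (absGaloisRestrict K (v.adicCompletion K) τ)) =
        absGaloisRestrict K (v.adicCompletion K) τ • θ a - θ a
      change φ.1 (absGaloisRestrict K (v.adicCompletion K) τ) =
        absGaloisRestrict K (v.adicCompletion K) τ • a - a at h1
      rw [h1, map_sub, hθ]
    have hsub : (W.kummerLocalConditionAt (p : ℤ) (v.adicCompletion K)).comap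
        (galoisCohomology.res (W.torsionGaloisModule (p : ℤ)) (v.adicCompletion K) 1) ≤ Hs := by
      rw [hHs]; exact (comap_res_kummerLocalConditionAt W (p : ℤ) (v.adicCompletion K)).le
    exact hsub (AddSubgroup.mem_comap.mpr key)
  -- finiteness
  haveI hL'fin : Finite L' := W'.finite_kummerLocalConditionAt_adicCompletion v hpp.ne_zero
  haveI : Finite U' := Finite.of_injective _ (AddSubgroup.inclusion_injective hU'L')
  have hAr : A.map r ≤ L' := by
    rintro _ ⟨a, ha, rfl⟩
    obtain ⟨c', hc', rfl⟩ := AddSubgroup.mem_map.mp ha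
    rw [← comap_res_kummerLocalConditionAt] at hc'
    have e : r ((h1Equiv θ hθ).toAddMonoidHom c') =
        galoisCohomology.res (W'.torsionGaloisModule (p : ℤ)) (v.adicCompletion K) 1 c' := by
      rw [hr_apply]
      congr 1
      exact (h1Equiv θ hθ).symm_apply_apply c'
    rw [e]
    exact hc'
  haveI : Finite (A.map r) := Finite.of_injective _ (AddSubgroup.inclusion_injective hAr)
  -- the index of `U′` in `L′` is `#(𝓞_v/p)`
  have hcardU' : Nat.card U' = Nat.card (nsmulAddMonoidHom p :
      (W'.baseChange (v.adicCompletion K)).toAffine.Point →+ _).ker := by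
    rw [hU', natCard_unramifiedSubgroup_eq_natCard_invariants_general ρ',
      hρ', natCard_invariants_torsion_restrictField W' (v.adicCompletion K) hpp.ne_zero]
  have hcardL' : Nat.card L' = Nat.card (nsmulAddMonoidHom p :
      (W'.baseChange (v.adicCompletion K)).toAffine.Point →+ _).ker *
      Nat.card (v.adicCompletionIntegers K ⧸ Ideal.span {(p : v.adicCompletionIntegers K)}) :=
    W'.natCard_kummerLocalConditionAt_adicCompletion v hpp.ne_zero
  have hUpos : 0 < Nat.card U' := Nat.card_pos
  have hmul : Nat.card U' * U'.relIndex L' = Nat.card L' := by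
    rw [← AddSubgroup.relIndex_bot_left, ← AddSubgroup.relIndex_bot_left (H := L')]
    exact AddSubgroup.relIndex_mul_relIndex ⊥ U' L' bot_le hU'L'
  have hidx : U'.relIndex L' =
      Nat.card (v.adicCompletionIntegers K ⧸ Ideal.span {(p : v.adicCompletionIntegers K)}) := by
    apply Nat.eq_of_mul_eq_mul_left hUpos
    rw [hmul, hcardL', hcardU']
  -- nonvanishing of the relative indices inside the finite group `L′`
  have hUL'ne : U'.relIndex L' ≠ 0 := by
    intro h0
    rw [h0, mul_zero] at hmul
    exact (Nat.card_pos (α := L')).ne' hmul.symm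
  have hUAr_ne : U'.relIndex (A.map r) ≠ 0 := by
    intro h0
    have hmul' : Nat.card (U' ⊓ A.map r : AddSubgroup _) * U'.relIndex (A.map r) =
        Nat.card (A.map r) := by
      have := AddSubgroup.relIndex_mul_relIndex ⊥ (U' ⊓ A.map r) (A.map r) bot_le inf_le_right
      rwa [AddSubgroup.relIndex_bot_left, AddSubgroup.relIndex_bot_left,
        AddSubgroup.inf_relIndex_right] at this
    rw [h0, mul_zero] at hmul'
    haveI : Finite (U' ⊓ A.map r : AddSubgroup _) :=
      Finite.of_injective _ (AddSubgroup.inclusion_injective (inf_le_right : U' ⊓ A.map r ≤ A.map r))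
    exact (Nat.card_pos (α := A.map r)).ne' hmul'.symm
  have hH₁A : H₁.relIndex A = U'.relIndex (A.map r) := by
    rw [hH₁, AddSubgroup.relIndex_comap]
  have hH₁A_ne : H₁.relIndex A ≠ 0 := by rw [hH₁A]; exact hUAr_ne
  calc Hs.relIndex A ≤ H₁.relIndex A := AddSubgroup.relIndex_le_of_le_left hH₁le hH₁A_ne
    _ = U'.relIndex (A.map r) := hH₁A
    _ ≤ U'.relIndex L' := AddSubgroup.relIndex_le_of_le_right hAr hUL'ne
    _ = _ := hidx

end Main

section Rat

/-- The finite place of `ℚ` over `3` has `#(ℤ₃/3) = 3`. [folklore] -/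
theorem natCard_quot_three_eq (v : HeightOneSpectrum (𝓞 ℚ)) (hv : (Rat.HeightOneSpectrum.primesEquiv v : ℕ) = 3) :
    Nat.card (v.adicCompletionIntegers ℚ ⧸ Ideal.span {((3 : ℕ) : v.adicCompletionIntegers ℚ)}) = 3 := by
  haveI : Fact (Nat.Prime 3) := ⟨Nat.prime_three⟩
  have hv_of : ∀ w : HeightOneSpectrum (𝓞 ℚ), ((3 : ℕ) : 𝓞 ℚ) ∈ w.asIdeal → w = v := by
    intro w hw
    apply (Rat.HeightOneSpectrum.primesEquiv (R := 𝓞 ℚ)).injective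
    exact Subtype.ext ((Rat.HeightOneSpectrum.primesEquiv_eq_of_natCast_mem w Nat.prime_three hw).trans hv.symm)
  have h := WeierstrassCurve.prod_natCard_quot_adicCompletionIntegers (K := ℚ) (p := 3) ({v} : Finset _)
    (fun w hw h3 ↦ hw (by rw [Finset.mem_singleton]; exact hv_of w h3))
  rw [Finset.prod_singleton, Module.finrank_self, pow_one] at h
  exact_mod_cast h

/-- **§3. The UNCONDITIONAL socket over `ℚ` at `p = 3`: visible `Ш(E)[3] ≠ 0` from a `3`-congruent
partner of rank `≥ 2`, BOTH curves GOOD at `3`, every other bad place of kind (i)** — no named fact at the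
place `3` (§2: `ι₃(θ) ≤ #(ℤ₃/3) = 3`, so `[E(ℚ):3E(ℚ)] · ∏ ι_v ≤ 1 · 3 < 9 ≤ [E′(ℚ):3E′(ℚ)]`; hook
`exists_sha_ne_zero_of_congr_of_relIndex_lt`). Data: integer models `E₀`, `F₀` with discriminants on a
prime list `L ∋ 3`, `3 ∤ Δ(E₀)Δ(F₀)`; `θ : E′[3] ⥲ E[3]` `Γ_ℚ`-equivariant; `E(ℚ)` finite of order prime
to `3`; `rank E′(ℚ) ≥ 2`; `#E′(ℚ_ℓ)[3] = 1` at every other listed place. Compare the kind-(v) socket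
`exists_sha_ne_zero_three_of_congr_goodAtThree_of_primeList` (`X10/SelfTwistVisibleGoodAtThree.lean`:
rank `≥ 1`, conditional on Mazur–Rubin `hMR`). [cite: CremonaMazur2000, §3 and Table 1]
[cite: AgasheStein2002, Thm. 3.1 and §3.5] [cite: MilneADT2006, Ch. I Prop. 3.8 and Lemma 2.9] -/
theorem exists_sha_ne_zero_three_of_congr_goodAtThree_rankTwo_of_primeList
    (W W' : WeierstrassCurve ℚ) [W.IsElliptic] [W'.IsElliptic]
    (θ : geomTorsion W' ((3 : ℕ) : ℤ) ≃+ geomTorsion W ((3 : ℕ) : ℤ))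
    (hθ : ∀ (σ : Field.absoluteGaloisGroup ℚ) (P : geomTorsion W' ((3 : ℕ) : ℤ)), θ (σ • P) = σ • θ P)
    {E₀ F₀ : WeierstrassCurve ℤ} (hE : E₀.map (Int.castRingHom ℚ) = W)
    (hF : F₀.map (Int.castRingHom ℚ) = W') (L : List ℕ) (h3L : 3 ∈ L)
    (hΔE : ∀ q : ℕ, q.Prime → (q : ℤ) ∣ E₀.Δ → q ∈ L)
    (hΔF : ∀ q : ℕ, q.Prime → (q : ℤ) ∣ F₀.Δ → q ∈ L)
    (h3E : ¬ ((3 : ℕ) : ℤ) ∣ E₀.Δ) (h3F : ¬ ((3 : ℕ) : ℤ) ∣ F₀.Δ)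
    (hfin : Finite W.toAffine.Point) (hcop : (Nat.card W.toAffine.Point).Coprime 3)
    (hrank : 2 ≤ W'.mordellWeilRank)
    (hplaces : ∀ v : HeightOneSpectrum (𝓞 ℚ), (Rat.HeightOneSpectrum.primesEquiv v : ℕ) ∈ L →
      (Rat.HeightOneSpectrum.primesEquiv v : ℕ) ≠ 3 →
      Nat.card (nsmulAddMonoidHom 3 :
        (W'.baseChange (v.adicCompletion ℚ)).toAffine.Point →+ _).ker = 1) :
    ∃ c : W.sha, c ≠ 0 ∧ 3 • c = 0 := by
  haveI : Fact (Nat.Prime 3) := ⟨Nat.prime_three⟩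
  haveI := hfin
  set e := Rat.HeightOneSpectrum.primesEquiv (R := 𝓞 ℚ) with he
  -- the finite set of places over `L`
  set S : Finset (HeightOneSpectrum (𝓞 ℚ)) :=
    (L.filterMap fun q ↦ if h : q.Prime then some (e.symm ⟨q, h⟩) else none).toFinset with hSdef
  have hmemS : ∀ v : HeightOneSpectrum (𝓞 ℚ), v ∈ S ↔ (e v : ℕ) ∈ L := by
    intro v
    rw [hSdef, List.mem_toFinset, List.mem_filterMap]
    constructor
    · rintro ⟨q, hq, hqv⟩
      by_cases hqp : q.Prime
      · rw [dif_pos hqp, Option.some.injEq] at hqv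
        rw [← hqv, Equiv.apply_symm_apply]
        exact hq
      · rw [dif_neg hqp] at hqv
        exact absurd hqv (by simp)
    · intro hv
      refine ⟨(e v : ℕ), hv, ?_⟩
      rw [dif_pos (e v).2]
      simp
  set v₃ : HeightOneSpectrum (𝓞 ℚ) := e.symm ⟨3, Nat.prime_three⟩ with hv₃def
  have hv₃ : (e v₃ : ℕ) = 3 := by rw [hv₃def, Equiv.apply_symm_apply]
  have hv₃S : v₃ ∈ S := (hmemS v₃).mpr (by rw [hv₃]; exact h3L)
  refine exists_sha_ne_zero_of_congr_of_relIndex_lt W W' (by norm_num) θ hθ S (fun v hvS ↦ ?_) ?_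
  · -- outside `S`: good reduction of both curves and `v ∤ 3`
    have hvL : (e v : ℕ) ∉ L := fun h ↦ hvS ((hmemS v).mpr h)
    have hq : (e v : ℕ).Prime := (e v).2
    refine ⟨?_, ?_, fun h3v ↦ hvL ?_⟩
    · rw [← hE]
      exact hasGoodReductionAt_map_of_not_dvd E₀ v fun h ↦ hvL (hΔE _ hq h)
    · rw [← hF]
      exact hasGoodReductionAt_map_of_not_dvd F₀ v fun h ↦ hvL (hΔF _ hq h)
    · rw [he, Rat.HeightOneSpectrum.primesEquiv_eq_of_natCast_mem v Nat.prime_three h3v]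
      exact h3L
  · -- the count: each `ι_v ≤ (if v = v₃ then 3 else 1)`, so `∏ ι_v ≤ 3`, and `1 · 3 < 9 ≤ [E′:3E′]`
    have hbound : ∀ v ∈ S, (selmerLocalKer W (v.adicCompletion ℚ) ((3 : ℕ) : ℤ)).relIndex
        ((selmerLocalKer W' (v.adicCompletion ℚ) ((3 : ℕ) : ℤ)).map (h1Equiv θ hθ).toAddMonoidHom) ≤
        (if v = v₃ then 3 else 1) := by
      intro v hvS
      have hvL : (e v : ℕ) ∈ L := (hmemS v).mp hvS
      by_cases hv : v = v₃
      · rw [if_pos hv]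
        have hv3 : (e v : ℕ) = 3 := by rw [hv]; exact hv₃
        have hgood : W.HasGoodReductionAt v := by
          rw [← hE]
          exact hasGoodReductionAt_map_of_not_dvd E₀ v (by rw [← he, hv3]; exact h3E)
        have hgood' : W'.HasGoodReductionAt v := by
          rw [← hF]
          exact hasGoodReductionAt_map_of_not_dvd F₀ v (by rw [← he, hv3]; exact h3F)
        have h := relIndex_map_selmerLocalKer_le_card_quot_of_hasGoodReductionAt W W' θ hθ hgood hgood'
        rwa [natCard_quot_three_eq v (by rw [← he]; exact hv3)] at h
      · rw [if_neg hv]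
        have hv3 : (e v : ℕ) ≠ 3 := fun h ↦ hv (by
          rw [hv₃def, Equiv.eq_symm_apply]; exact Subtype.ext h)
        have h3v : ((3 : ℕ) : 𝓞 ℚ) ∉ v.asIdeal := fun h ↦
          hv3 (Rat.HeightOneSpectrum.primesEquiv_eq_of_natCast_mem v Nat.prime_three h)
        exact (relIndex_map_selmerLocalKer_eq_one_of_card_torsion_eq_one W W' θ hθ h3v
          (hplaces v hvL hv3)).le
    have hprod : ∏ v ∈ S, (selmerLocalKer W (v.adicCompletion ℚ) ((3 : ℕ) : ℤ)).relIndex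
        ((selmerLocalKer W' (v.adicCompletion ℚ) ((3 : ℕ) : ℤ)).map (h1Equiv θ hθ).toAddMonoidHom) ≤ 3 := by
      refine (Finset.prod_le_prod' hbound).trans ?_
      rw [Finset.prod_ite_eq' S v₃ (fun _ ↦ (3 : ℕ)), if_pos hv₃S]
    -- (the `AddCommGroup` structure on `E(ℚ)` in the hook carries the classical `DecidableEq ℚ`; `convert`)
    have h1 := index_range_zsmul_eq_one_of_coprime (p := 3) hcop
    have h2 := pow_mordellWeilRank_le_index_range_zsmul W' (n := 3) (by norm_num)
    have h9 : (1 : ℕ) * 3 < 3 ^ W'.mordellWeilRank :=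
      lt_of_lt_of_le (by norm_num) (Nat.pow_le_pow_right (by norm_num) hrank)
    refine lt_of_le_of_lt (Nat.mul_le_mul (le_of_eq ?_) hprod) (lt_of_lt_of_le h9 ?_)
    · convert h1
    · convert h2

end Rat

end Summit.BirchSwinnertonDyer.Rank1Residual.X10.SelfTwist

end
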